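import Literature.Geometry.Riemannian.PerelmanEntropyFormulaManifold
import Literature.Geometry.Riemannian.MaximumPrincipleAtMaxima
import HarnessLib

/-!
# Positivity of conjugate heat solutions with positive final data, and Perelman's no local
# collapsing theorem from the LINEAR backward solvability of `□* u = 0`

`PerelmanEntropyFormulaManifold.lean` reduces the named fact `perelman_noLocalCollapsing`
(`CanonicalNeighbourhoods.lean`; Perelman 2002, §4, Thm. 4.1) to (CH): on a closed manifold
modelled on `ℝ^m` carrying a Ricci flow, every smooth positive `u₁` is the value at `t₀` of a
POSITIVE smooth solution `u` of the conjugate heat equation `□* u = −∂ₜu − Δu + Ru = 0` on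
`M × [0, t₀]`. The positivity of `u` is automatic: it is the parabolic minimum principle for the
time-reversed equation `∂ₛũ = Δũ − Rũ` (Topping 2006, Thm. 3.1.1 / Cor. 3.1.2, in the
maximum-point form `le_zero_of_deriv_le_mul_at_isMaxOn`; Topping, §6.4: the conjugate heat
equation is solved backwards "with a positive solution"). This file PROVES it and records the
named fact as a consequence of the bare linear existence statement:

* `hasDerivWithinAt_time_reverse` — the chain rule for `s ↦ φ(T' − s)` within `[0, T']`;
* `IsRicciFlow.nonneg_of_isConjugateHeatSolutionOn`, `IsRicciFlow.pos_of_isConjugateHeatSolutionOn`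
  — **a smooth solution of `□* u = 0` on `M × [0, T']` along a Ricci flow of Riemannian metrics on
  a closed manifold with `u(·, T') ≥ 0` (resp. `> 0`) is `≥ 0` (resp. `> 0`) on `M × [0, T']`**
  (with the explicit bound `u(x, t) ≥ (min u(·, T')) e^{−K(T' − t)}`, `K ≥ sup |R|`, in the proof);
* `perelman_noLocalCollapsing_of_conjugateHeat_solvable` — **`perelman_noLocalCollapsing` follows
  from the solvability of the final value problem for the linear equation `□* u = 0`** with smooth
  positive final data on closed manifolds modelled on `ℝ^m` carrying a Ricci flow (standard linear
  parabolic theory, e.g. Topping 2006, Rem. 8.2.5; absent from Mathlib and the tree). NOT a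
  discharge of the named fact.

Everything is proved; no definition, no named fact.

## References

* P. Topping, *Lectures on the Ricci flow*, LMS Lecture Note Series 325, CUP 2006, Thm. 3.1.1,
  Cor. 3.1.2 (p. 35); §6.4, (6.4.8); §8.2, Rem. 8.2.5; §8.3, Thm. 8.3.1. [Topping2006]
* G. Perelman, *The entropy formula for the Ricci flow and its geometric applications*,
  arXiv:math/0211159 (2002), §3.1; §4, Thm. 4.1. [Perelman2002]
-/

noncomputable section

open Set Function Filter Manifold Bundle MeasureTheory Module
open scoped Manifold ContDiff Topology

namespace Literature.Geometry.Riemannian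

open Lorentzian Lorentzian.PseudoRiemannianMetric

universe u v w

/-- **Chain rule for the time reversal `s ↦ T' − s` within `[0, T']`**: if `φ` has derivative `φ'`
within `[0, T']` at `T' − s`, `s ∈ [0, T']`, then `s ↦ φ (T' − s)` has derivative `−φ'` within
`[0, T']` at `s`. [folklore] -/
theorem hasDerivWithinAt_time_reverse {φ : ℝ → ℝ} {φ' T' s : ℝ}
    (hφ : HasDerivWithinAt φ φ' (Icc 0 T') (T' - s)) :
    HasDerivWithinAt (fun r ↦ φ (T' - r)) (-φ') (Icc 0 T') s := by
  have hρ : HasDerivWithinAt (fun r : ℝ ↦ T' - r) (-1) (Icc 0 T') s := by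
    simpa using (hasDerivWithinAt_id s (Icc 0 T')).const_sub T'
  have hmaps : MapsTo (fun r : ℝ ↦ T' - r) (Icc 0 T') (Icc 0 T') := fun r hr ↦
    ⟨by linarith [hr.2], by linarith [hr.1]⟩
  exact (hφ.scomp s hρ hmaps).congr_deriv (by simp)

section Positivity

variable {E : Type*} [NormedAddCommGroup E] [NormedSpace ℝ E] [FiniteDimensional ℝ E]
  [CompleteSpace E] {H : Type*} [TopologicalSpace H] {I : ModelWithCorners ℝ E H} [I.Boundaryless]
  {M : Type*} [TopologicalSpace M] [ChartedSpace H M] [IsManifold I ∞ M] [CompactSpace M]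
  {g : ℝ → PseudoRiemannianMetric I ∞ E (TangentSpace I : M → Type _)}
  {cov : ℝ → CovariantDerivative I E (TangentSpace I : M → Type _)}

/-- **Nonnegativity of conjugate heat solutions with nonnegative final data** (parabolic minimum
principle, Topping 2006, Cor. 3.1.2, for the time-reversed equation `∂ₛũ = Δũ − Rũ`): along a
Ricci flow of Riemannian metrics on `[0, T']` on a closed manifold, a smooth solution `u` of
`□* u = 0` on `M × [0, T']` with `u(·, T') ≥ 0` is `≥ 0` on `M × [0, T']`. Proof: apply the
maximum-point principle `le_zero_of_deriv_le_mul_at_isMaxOn` to `f(s, x) = −u(T' − s, x)`: at a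
positive spatial maximum of `f(s, ·)`, `Δ_{g}(−u) ≤ 0` (`laplaceBeltrami_nonpos_of_isMaxOn`) and
`∂ₛf = Δ(−u) − R f... ≤ K f` with `K ≥ sup |R|`. [cite: Topping2006, Cor. 3.1.2 (p. 35)] -/
theorem IsRicciFlow.nonneg_of_isConjugateHeatSolutionOn {T' : ℝ}
    (h : IsRicciFlow g cov (Icc 0 T')) (hR : ∀ t ∈ Icc 0 T', (g t).IsRiemannian)
    {u : ℝ → M → ℝ} (hsol : IsConjugateHeatSolutionOn g cov (Icc 0 T') u)
    (hfin : ∀ x, 0 ≤ u T' x) : ∀ t ∈ Icc 0 T', ∀ x, 0 ≤ u t x := by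
  have h2 : (2 : ℕ∞ω) ≤ ∞ := WithTop.coe_le_coe.mpr le_top
  have hu := hsol.1
  have hpde := hsol.2
  -- a bound `K ≥ |R|` on `M × [0, T']`
  have hRc : ContinuousOn (fun p : M × ℝ ↦ (g p.2).scalarCurvatureWith (cov p.2) p.1)
      (univ ×ˢ Icc 0 T') := h.contMDiffOn_scalarCurvatureWith.continuousOn
  obtain ⟨K₀, hK₀⟩ := (isCompact_univ.prod isCompact_Icc).exists_bound_of_continuousOn hRc
  set K : ℝ := max K₀ 0 with hKdef
  have hK0 : 0 ≤ K := le_max_right _ _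
  have hRK : ∀ t ∈ Icc 0 T', ∀ x, |(g t).scalarCurvatureWith (cov t) x| ≤ K := fun t ht x ↦ by
    have h' := hK₀ (x, t) ⟨mem_univ _, ht⟩
    rw [Real.norm_eq_abs] at h'
    exact h'.trans (le_max_left _ _)
  -- the time reversal
  have hmaps : ∀ s ∈ Icc (0 : ℝ) T', T' - s ∈ Icc (0 : ℝ) T' := fun s hs ↦
    ⟨by linarith [hs.2], by linarith [hs.1]⟩
  have hcont : ContinuousOn (fun p : M × ℝ ↦ -u (T' - p.2) p.1) (univ ×ˢ Icc 0 T') := by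
    have hc := hu.continuousOn
    have hρ : Continuous (fun p : M × ℝ ↦ (p.1, T' - p.2)) := by fun_prop
    exact (hc.comp hρ.continuousOn fun p hp ↦ ⟨mem_univ _, hmaps p.2 hp.2⟩).neg
  have hderiv : ∀ s ∈ Icc 0 T', ∀ x, HasDerivWithinAt (fun r ↦ -u (T' - r) x)
      (-((g (T' - s)).laplaceBeltrami (u (T' - s)) x -
        (g (T' - s)).scalarCurvatureWith (cov (T' - s)) x * u (T' - s) x)) (Icc 0 T') s := by
    intro s hs x
    have hd := hasDerivWithinAt_time (n := ∞) (by simp) hu x (hmaps s hs)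
    rw [hpde (T' - s) (hmaps s hs) x] at hd
    have hrev := hasDerivWithinAt_time_reverse (T' := T') (s := s) hd
    exact hrev.neg.congr_deriv (by ring)
  have hmax : ∀ s ∈ Ioc 0 T', ∀ x, IsMaxOn (fun y ↦ -u (T' - s) y) univ x →
      0 < -u (T' - s) x →
      -((g (T' - s)).laplaceBeltrami (u (T' - s)) x -
        (g (T' - s)).scalarCurvatureWith (cov (T' - s)) x * u (T' - s) x) ≤
        K * (-u (T' - s) x) := by
    intro s hs x hxmax hxpos
    have hs' : T' - s ∈ Icc 0 T' := hmaps s ⟨hs.1.le, hs.2⟩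
    -- `Δ(-u) ≤ 0` at the maximum
    have hΔ : (g (T' - s)).laplaceBeltrami (fun y ↦ -u (T' - s) y) x ≤ 0 :=
      laplaceBeltrami_nonpos_of_isMaxOn (g (T' - s)) (fun v hv ↦ hR _ hs' x v hv)
        ((contMDiff_slice_of_contMDiffOn hu hs').neg.of_le h2) hxmax
    have hneg : (g (T' - s)).laplaceBeltrami (fun y ↦ -u (T' - s) y) x =
        -(g (T' - s)).laplaceBeltrami (u (T' - s)) x :=
      (g (T' - s)).laplaceBeltrami_neg (u (T' - s)) x
    rw [hneg] at hΔ
    -- `R u = -R (-u) ≤ K (-u)`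
    have hRu : (g (T' - s)).scalarCurvatureWith (cov (T' - s)) x * u (T' - s) x ≤
        K * (-u (T' - s) x) := by
      have hab := hRK _ hs' x
      have h1 : -(g (T' - s)).scalarCurvatureWith (cov (T' - s)) x ≤ K :=
        (neg_le_abs _).trans hab
      nlinarith
    linarith
  have hu0 : ∀ x, -u (T' - 0) x ≤ 0 := fun x ↦ by
    rw [sub_zero]
    exact neg_nonpos.2 (hfin x)
  have key := le_zero_of_deriv_le_mul_at_isMaxOn (T := T') (u := fun s y ↦ -u (T' - s) y)
    hcont hderiv K hmax hu0
  intro t ht x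
  have h' := key (T' - t) (hmaps t ht) x
  simp only [sub_sub_cancel] at h'
  linarith

/-- **Positivity of conjugate heat solutions with positive final data** (Topping 2006, §6.4 with
Cor. 3.1.2): along a Ricci flow of Riemannian metrics on `[0, T']`, `T' > 0`, on a closed
manifold, a smooth solution `u` of `□* u = 0` on `M × [0, T']` with `u(·, T') > 0` is `> 0` on
`M × [0, T']`; indeed `u(x, t) ≥ α e^{−K(T' − t)}` with `α = min u(·, T')`, `K ≥ sup |R|`
(the maximum-point principle applied to `α e^{−Ks} − u(T' − s, ·)`, using `u ≥ 0` from
`nonneg_of_isConjugateHeatSolutionOn`). [cite: Topping2006, §6.4 and Cor. 3.1.2 (p. 35)] -/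
theorem IsRicciFlow.pos_of_isConjugateHeatSolutionOn {T' : ℝ} (hT' : 0 < T')
    (h : IsRicciFlow g cov (Icc 0 T')) (hR : ∀ t ∈ Icc 0 T', (g t).IsRiemannian)
    {u : ℝ → M → ℝ} (hsol : IsConjugateHeatSolutionOn g cov (Icc 0 T') u)
    (hfin : ∀ x, 0 < u T' x) : ∀ t ∈ Icc 0 T', ∀ x, 0 < u t x := by
  rcases isEmpty_or_nonempty M with hM | hM
  · intro t _ x
    exact (IsEmpty.false x).elim
  have h2 : (2 : ℕ∞ω) ≤ ∞ := WithTop.coe_le_coe.mpr le_top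
  have hu := hsol.1
  have hpde := hsol.2
  have hnonneg := h.nonneg_of_isConjugateHeatSolutionOn hR hsol fun x ↦ (hfin x).le
  -- a bound `K ≥ |R|` on `M × [0, T']`
  have hRc : ContinuousOn (fun p : M × ℝ ↦ (g p.2).scalarCurvatureWith (cov p.2) p.1)
      (univ ×ˢ Icc 0 T') := h.contMDiffOn_scalarCurvatureWith.continuousOn
  obtain ⟨K₀, hK₀⟩ := (isCompact_univ.prod isCompact_Icc).exists_bound_of_continuousOn hRc
  set K : ℝ := max K₀ 0 with hKdef
  have hK0 : 0 ≤ K := le_max_right _ _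
  have hRK : ∀ t ∈ Icc 0 T', ∀ x, |(g t).scalarCurvatureWith (cov t) x| ≤ K := fun t ht x ↦ by
    have h' := hK₀ (x, t) ⟨mem_univ _, ht⟩
    rw [Real.norm_eq_abs] at h'
    exact h'.trans (le_max_left _ _)
  -- the minimum `α > 0` of the final data
  have hT'mem : T' ∈ Icc (0 : ℝ) T' := ⟨hT'.le, le_rfl⟩
  obtain ⟨x₀, -, hx₀⟩ := isCompact_univ.exists_isMinOn univ_nonempty
    (contMDiff_slice_of_contMDiffOn hu hT'mem).continuous.continuousOn
  set α : ℝ := u T' x₀ with hαdef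
  have hα : 0 < α := hfin x₀
  have hαle : ∀ x, α ≤ u T' x := fun x ↦ hx₀ (mem_univ x)
  -- the time reversal
  have hmaps : ∀ s ∈ Icc (0 : ℝ) T', T' - s ∈ Icc (0 : ℝ) T' := fun s hs ↦
    ⟨by linarith [hs.2], by linarith [hs.1]⟩
  have hcont : ContinuousOn (fun p : M × ℝ ↦ α * Real.exp (-K * p.2) - u (T' - p.2) p.1)
      (univ ×ˢ Icc 0 T') := by
    have hc := hu.continuousOn
    have hρ : Continuous (fun p : M × ℝ ↦ (p.1, T' - p.2)) := by fun_prop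
    have he : Continuous (fun p : M × ℝ ↦ α * Real.exp (-K * p.2)) := by fun_prop
    exact he.continuousOn.sub (hc.comp hρ.continuousOn fun p hp ↦ ⟨mem_univ _, hmaps p.2 hp.2⟩)
  have hderiv : ∀ s ∈ Icc 0 T', ∀ x,
      HasDerivWithinAt (fun r ↦ α * Real.exp (-K * r) - u (T' - r) x)
        (-K * (α * Real.exp (-K * s)) -
          ((g (T' - s)).laplaceBeltrami (u (T' - s)) x -
            (g (T' - s)).scalarCurvatureWith (cov (T' - s)) x * u (T' - s) x)) (Icc 0 T') s := by
    intro s hs x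
    have hd := hasDerivWithinAt_time (n := ∞) (by simp) hu x (hmaps s hs)
    rw [hpde (T' - s) (hmaps s hs) x] at hd
    have hrev := hasDerivWithinAt_time_reverse (T' := T') (s := s) hd
    have hexp : HasDerivWithinAt (fun r ↦ α * Real.exp (-K * r))
        (α * (Real.exp (-K * s) * (-K * 1))) (Icc 0 T') s :=
      (((hasDerivAt_id s).const_mul (-K)).exp.const_mul α).hasDerivWithinAt
    exact (hexp.sub hrev).congr_deriv (by ring)
  have hmax : ∀ s ∈ Ioc 0 T', ∀ x,
      IsMaxOn (fun y ↦ α * Real.exp (-K * s) - u (T' - s) y) univ x →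
      0 < α * Real.exp (-K * s) - u (T' - s) x →
      -K * (α * Real.exp (-K * s)) -
          ((g (T' - s)).laplaceBeltrami (u (T' - s)) x -
            (g (T' - s)).scalarCurvatureWith (cov (T' - s)) x * u (T' - s) x) ≤
        0 * (α * Real.exp (-K * s) - u (T' - s) x) := by
    intro s hs x hxmax hxpos
    have hs' : T' - s ∈ Icc 0 T' := hmaps s ⟨hs.1.le, hs.2⟩
    -- `x` is a maximum of `-u(T' - s, ·)` as well
    have hxmax' : IsMaxOn (fun y ↦ -u (T' - s) y) univ x := by
      intro y _
      have hy := hxmax (mem_univ y)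
      simp only [mem_setOf_eq] at hy ⊢
      linarith
    have hΔ : (g (T' - s)).laplaceBeltrami (fun y ↦ -u (T' - s) y) x ≤ 0 :=
      laplaceBeltrami_nonpos_of_isMaxOn (g (T' - s)) (fun v hv ↦ hR _ hs' x v hv)
        ((contMDiff_slice_of_contMDiffOn hu hs').neg.of_le h2) hxmax'
    have hneg : (g (T' - s)).laplaceBeltrami (fun y ↦ -u (T' - s) y) x =
        -(g (T' - s)).laplaceBeltrami (u (T' - s)) x :=
      (g (T' - s)).laplaceBeltrami_neg (u (T' - s)) x
    rw [hneg] at hΔ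
    -- `R u ≤ K u` since `u ≥ 0`
    have hupos : 0 ≤ u (T' - s) x := hnonneg _ hs' x
    have hRu : (g (T' - s)).scalarCurvatureWith (cov (T' - s)) x * u (T' - s) x ≤
        K * u (T' - s) x :=
      mul_le_mul_of_nonneg_right ((le_abs_self _).trans (hRK _ hs' x)) hupos
    have hexp0 : 0 < α * Real.exp (-K * s) := mul_pos hα (Real.exp_pos _)
    nlinarith
  have hu0 : ∀ x, α * Real.exp (-K * 0) - u (T' - 0) x ≤ 0 := fun x ↦ by
    rw [mul_zero, Real.exp_zero, mul_one, sub_zero]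
    linarith [hαle x]
  have key := le_zero_of_deriv_le_mul_at_isMaxOn (T := T')
    (u := fun s y ↦ α * Real.exp (-K * s) - u (T' - s) y) hcont hderiv 0 hmax hu0
  intro t ht x
  have h' := key (T' - t) (hmaps t ht) x
  simp only [sub_sub_cancel] at h'
  have hexp0 : 0 < α * Real.exp (-K * (T' - t)) := mul_pos hα (Real.exp_pos _)
  linarith

end Positivity

/-! ### Perelman's no local collapsing theorem from the linear solvability of `□* u = 0` -/

/-- **Perelman's no local collapsing theorem I from the backward solvability of the LINEAR
conjugate heat equation on manifolds modelled on `ℝ^m`** (Perelman 2002, §3.1, §4, Thm. 4.1;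
Topping 2006, Rem. 8.2.5, §6.4, Prop. 8.2.6, Thm. 8.3.1). Over all closed manifolds modelled on
`EuclideanSpace ℝ (Fin m)` (all `m`) carrying a Ricci flow of Riemannian metrics `(g, cov)` on
`[0, T)` and all `0 < t₀ < T`, assume
* `hCH`: every smooth positive `u₁ : M → ℝ` is the value at `t₀` of SOME smooth solution `u` of
  `□* u = 0` on `M × [0, t₀]` (`IsConjugateHeatSolutionOn`; the final value problem for a linear
  parabolic equation, Topping Rem. 8.2.5).
Then `perelman_noLocalCollapsing` holds (every model space): the positivity of `u` required by
`perelman_noLocalCollapsing_of_conjugateHeat_existence` is `pos_of_isConjugateHeatSolutionOn`.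
NOT a discharge of the named fact: linear parabolic existence theory on closed manifolds is not
in Mathlib or the tree. [cite: Perelman2002, §4, Thm. 4.1] [cite: Topping2006, §8.2, Rem. 8.2.5; §8.3, Thm. 8.3.1] -/
theorem perelman_noLocalCollapsing_of_conjugateHeat_solvable
    (hCH : ∀ (m : ℕ) {H : Type v} [TopologicalSpace H]
      (I : ModelWithCorners ℝ (EuclideanSpace ℝ (Fin m)) H) [I.Boundaryless]
      (M : Type w) [TopologicalSpace M] [T2Space M] [SecondCountableTopology M] [CompactSpace M]
      [ChartedSpace H M] [IsManifold I ∞ M] [MeasurableSpace M] [BorelSpace M] (T : ℝ), 0 < T →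
      ∀ (g : ℝ → PseudoRiemannianMetric I ∞ (EuclideanSpace ℝ (Fin m)) (TangentSpace I : M → Type _))
        (cov : ℝ → CovariantDerivative I (EuclideanSpace ℝ (Fin m)) (TangentSpace I : M → Type _)),
        IsRicciFlow g cov (Ico 0 T) → (∀ t ∈ Ico 0 T, (g t).IsRiemannian) →
        ∀ t₀ ∈ Ioo 0 T, ∀ u₁ : M → ℝ, ContMDiff I 𝓘(ℝ, ℝ) ∞ u₁ → (∀ x, 0 < u₁ x) →
          ∃ u : ℝ → M → ℝ, u t₀ = u₁ ∧ IsConjugateHeatSolutionOn g cov (Icc 0 t₀) u) :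
    perelman_noLocalCollapsing.{u, v, w} :=
  perelman_noLocalCollapsing_of_conjugateHeat_existence
    fun m _H _ I _ M _ _ _ _ _ _ _ _ T hT g cov hflow hRiem t₀ ht₀ u₁ hu₁ hu₁p ↦ by
      obtain ⟨u, huT, hsol⟩ := hCH m I M T hT g cov hflow hRiem t₀ ht₀ u₁ hu₁ hu₁p
      refine ⟨u, huT, ?_, hsol⟩
      have hflow' : IsRicciFlow g cov (Icc 0 t₀) :=
        hflow.mono fun s hs ↦ ⟨hs.1, hs.2.trans_lt ht₀.2⟩
      exact hflow'.pos_of_isConjugateHeatSolutionOn ht₀.1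
        (fun s hs ↦ hRiem s ⟨hs.1, hs.2.trans_lt ht₀.2⟩) hsol
        (fun x ↦ by rw [huT]; exact hu₁p x)

end Literature.Geometry.Riemannian

end
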